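import Literature.Probability.RandomPlanarGeometry.PlusHullExtension
import Literature.Probability.RandomPlanarGeometry.KernelConvergence
import Literature.Probability.RandomPlanarGeometry.ConformalMapRiemannProofs
import Literature.Analysis.Complex.Montel
import Literature.Analysis.Complex.Hurwitz
import Literature.Analysis.Complex.RiemannMapping
import Literature.Analysis.Complex.InjectiveHolomorphic
import Mathlib.Analysis.Complex.LocallyUniformLimit
import HarnessLib

/-!
# A kernel theorem for hulls swallowing the boundary of `A`: `E_{A_n} → E_A` on `Ω_A`

G. F. Lawler, O. Schramm, W. Werner, *Conformal restriction: the chordal case*, J. Amer. Math.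
Soc. **16** (2003), proof of Lemma 3.5 (arXiv p. 13): the hull `E_δ` bounded by a simple path
`β` is approximated through the Loewner chain of `β`, i.e. through the slits `β[0, t] ↑`, whose
maps converge to `Φ_{E_δ}` ("`Φ^{(n)}_s(z) → Φ_s(z) = Φ_{E_δ}` locally uniformly in `ℍ̄ ∖ E_δ`").
The convergence of the maps of an increasing family of hulls to the map of the limit hull is a
Carathéodory kernel theorem (Ch. Pommerenke, *Boundary Behaviour of Conformal Maps* (1992),
Thm. 1.8; for half-plane hulls G. F. Lawler, *Conformally Invariant Processes in the Plane*
(2005), Prop. 3.63/3.68). This file proves the version needed for slits growing INTO a hull,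
where the kernel of `ℍ ∖ A_n` is NOT `ℍ ∖ A` but `(ℍ ∖ A) ⊔ int A` (the region enclosed by the
path is cut off in the limit), so that the tree's kernel theorem
(`KernelConvergence`, hypothesis `int ⋂ (ℍ ∖ A_n) = ℍ ∖ A`) does not apply:

* `IsPlusHull.tendstoLocallyUniformlyOn_extMap_of_frontier` — let `A, A_n ∈ 𝒬₊` be nonempty
  with `Ω_A ⊆ Ω_{A_n}` (the symmetric domains of `PlusHullExtension`; equivalently
  `A_n ∪ Ā_n ∪ [x₀ⁿ, x₁ⁿ] ⊆ A ∪ Ā ∪ [x₀, x₁]`), suppose the Schwarz-reflected maps `E_{A_n}` move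
  points by at most `C` (`‖E_{A_n} z - z‖ ≤ C` on `Ω_{A_n}`, uniformly in `n` — Lawler's (3.12)),
  and suppose every point of `ℍ ∩ ∂A` lies in `A_n` for all large `n`. Then
  **`E_{A_n} → E_A` locally uniformly on `Ω_A`** — in particular uniformly on every compact
  subset of `ℍ̄ ∖ (A ∪ [x₀, x₁])`, the convergence of [LSW] Lemma 3.5 (p. 12).

## Proof (normal families)

By Montel (`Literature.Analysis.Complex.Montel`) a subsequence `E_{n_k} → E*` locally uniformly on
`Ω_A` (`E_n - id` is bounded by `C`), and the inverse maps `f_n = Φ_{A_n}⁻¹ : ℍ → ℍ ∖ A_n`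
(`|f_n - id| ≤ C`, `im f_n ≥ im`) have `f_{n_k} → f*` locally uniformly on `ℍ` along a further
subsequence; `f* : ℍ → ℍ` is injective (Hurwitz, `Complex.exists_eqOn_const_or_injOn_…`).
By Hurwitz again `f*(ℍ)` misses `ℍ ∩ ∂A` (each such point is eventually in `A_n`, i.e. omitted by
`f_n`); being connected and containing far points (`|f*(iM) - iM| ≤ C`) it lies in `ℍ ∖ A`.
Passing to the limit in `E_{n_k}(f_{n_k}(w)) = w` gives `E* ∘ f* = id` on `ℍ`, whence
`E* : ℍ ∖ A → ℍ` is a conformal bijection (injective by Hurwitz, into `ℍ` by the open mapping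
theorem) with `E*(0) = 0` and `E*(z)/z → 1`: a restriction map of `A`, so `E* = Φ_A` on `ℍ ∖ A`
(uniqueness, `IsPlusHull.eqOn_baseMap`) and `E* = E_A` on the connected `Ω_A` (identity theorem).
Every subsequence having such a sub-subsequence, the whole sequence converges.

## References

* [LSW] proof of Lemma 3.5, p. 13 [LawlerSchrammWerner2003Restriction].
* Ch. Pommerenke, *Boundary Behaviour of Conformal Maps* (1992), Thm. 1.8 [PommerenkeBBCM1992].
* G. F. Lawler (2005), Prop. 3.63, 3.68 [Lawler2005].
-/

noncomputable section

open Set Filter Metric Complex Bornology Function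
open _root_.Topology
open UpperHalfPlane (upperHalfPlaneSet isOpen_upperHalfPlaneSet)
open scoped ComplexConjugate

namespace Literature.Probability.RandomPlanarGeometry

/-! ### Two elementary facts on locally uniform convergence -/

/-- Adding the identity to a locally uniformly convergent sequence. [folklore] -/
theorem tendstoLocallyUniformlyOn_add_id {s : Set ℂ} {F : ℕ → ℂ → ℂ} {f : ℂ → ℂ}
    (h : TendstoLocallyUniformlyOn F f atTop s) :
    TendstoLocallyUniformlyOn (fun n z ↦ F n z + z) (fun z ↦ f z + z) atTop s := by
  rw [Metric.tendstoLocallyUniformlyOn_iff] at h ⊢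
  intro ε hε x hx
  obtain ⟨t, ht, hev⟩ := h ε hε x hx
  refine ⟨t, ht, hev.mono fun n hn y hy ↦ ?_⟩
  rw [dist_add_right]
  exact hn y hy

/-- A subsequence of a locally uniformly convergent sequence converges locally uniformly. [folklore] -/
theorem tendstoLocallyUniformlyOn_comp_strictMono {s : Set ℂ} {F : ℕ → ℂ → ℂ} {f : ℂ → ℂ}
    (h : TendstoLocallyUniformlyOn F f atTop s) {φ : ℕ → ℕ} (hφ : StrictMono φ) :
    TendstoLocallyUniformlyOn (fun n ↦ F (φ n)) f atTop s := by
  rw [Metric.tendstoLocallyUniformlyOn_iff] at h ⊢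
  intro ε hε x hx
  obtain ⟨t, ht, hev⟩ := h ε hε x hx
  exact ⟨t, ht, hφ.tendsto_atTop.eventually hev⟩

/-! ### The symmetric domain `Ω_A` -/

section PlusDomain

variable {A : Set ℂ} (hA : IsPlusHull A) (hne : A.Nonempty)
include hA hne

/-- **`Ω_A` is connected** (the increasing union of the slit domains `Ω_p`, `p ∈ [x₀/2, x₀)`, all
containing `0`). [folklore] -/
theorem IsPlusHull.isPreconnected_plusDomain : IsPreconnected (plusDomain A) := by
  set ι := {p : ℝ // leftPt A / 2 ≤ p ∧ p < leftPt A}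
  have hpos : ∀ i : ι, 0 < (i : ℝ) := fun i ↦ lt_of_lt_of_le (hA.half_leftPt_pos hne) i.2.1
  have heq : plusDomain A = ⋃ i : ι, slitDomain A i (rightPt A) := by
    refine Subset.antisymm (fun z hz ↦ ?_) (iUnion_subset fun i ↦ hA.slitDomain_subset_plusDomain hne i.2.2.le)
    obtain ⟨p, hp1, hp2, hzp⟩ := hA.exists_mem_slitDomain hne hz
    exact mem_iUnion.2 ⟨⟨p, hp1, hp2⟩, hzp⟩
  rw [heq]
  refine isPreconnected_iUnion ⟨0, mem_iInter.2 fun i ↦ ?_⟩ fun i ↦ ?_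
  · exact (hA.isSlitHull_of_lt hne (hpos i) i.2.2).zero_mem_slitDomain
  · exact (hA.isSlitHull_of_lt hne (hpos i) i.2.2).isConnected_slitDomain.isPreconnected

/-- **`im E_A(z) ≤ im z`** on `ℍ ∖ A`. [folklore] -/
theorem IsPlusHull.extMap_im_le_im {z : ℂ} (hz : z ∈ upperHalfPlaneSet \ A) :
    (hA.extMap hne z).im ≤ z.im := by
  obtain ⟨L, hL⟩ := (hA.baseSlit hne).exists_tendsto_ext_sub
  rw [hA.extMap_eq_base hne ((hA.baseSlit hne).diff_subset_slitDomain hz)]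
  exact (hA.baseSlit hne).im_ext_le_im hL hz

omit hne in
/-- `Ω_A ⊆ Ω_B` forces `B ∩ ℍ ⊆ A`, i.e. `ℍ ∖ A ⊆ ℍ ∖ B`. [folklore] -/
theorem IsPlusHull.diff_subset_diff_of_plusDomain_subset {B : Set ℂ} (hB : IsPlusHull B)
    (hdom : plusDomain A ⊆ plusDomain B) : upperHalfPlaneSet \ A ⊆ upperHalfPlaneSet \ B :=
  fun _ hz ↦ ⟨hz.1, (hB.mem_plusDomain_iff_of_im_pos hz.1).1 (hdom (hA.diff_subset_plusDomain hz))⟩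

end PlusDomain

/-! ### The kernel theorem -/

section Kernel

variable {A : Set ℂ} (hA : IsPlusHull A) (hne : A.Nonempty)
  {An : ℕ → Set ℂ} (hAn : ∀ n, IsPlusHull (An n)) (hnen : ∀ n, (An n).Nonempty)
  (hdom : ∀ n, plusDomain A ⊆ plusDomain (An n))
  {C : ℝ} (hC : ∀ n, ∀ z ∈ plusDomain (An n), ‖(hAn n).extMap (hnen n) z - z‖ ≤ C)
  (hfr : ∀ z ∈ upperHalfPlaneSet ∩ frontier A, ∀ᶠ n in atTop, z ∈ An n)
include hA hne hAn hnen hdom hC hfr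

/-- **A convergent subsequence with the right limit.** Under the hypotheses of
`IsPlusHull.tendstoLocallyUniformlyOn_extMap_of_frontier`, some subsequence `E_{A_{n_k}}`
converges to `E_A` locally uniformly on `Ω_A` (Montel, Hurwitz, uniqueness of `Φ_A`, identity
theorem; see the module docstring). [cite: PommerenkeBBCM1992, Thm. 1.8] -/
theorem IsPlusHull.exists_strictMono_tendstoLocallyUniformlyOn_extMap :
    ∃ φ : ℕ → ℕ, StrictMono φ ∧
      TendstoLocallyUniformlyOn (fun k ↦ (hAn (φ k)).extMap (hnen (φ k))) (hA.extMap hne) atTop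
        (plusDomain A) := by
  -- notation and basic facts
  set U : Set ℂ := plusDomain A with hU
  set V : Set ℂ := upperHalfPlaneSet \ A with hV
  set E : ℕ → ℂ → ℂ := fun n ↦ (hAn n).extMap (hnen n) with hE
  set f : ℕ → ℂ → ℂ := fun n w ↦ ((hAn n).baseMap (hnen n)).symm w with hf
  have hUo : IsOpen U := hA.isOpen_plusDomain
  have hUc : IsPreconnected U := hA.isPreconnected_plusDomain hne
  have hVU : V ⊆ U := hA.diff_subset_plusDomain
  have hVo : IsOpen V := isOpen_upperHalfPlaneSet.sdiff hA.1.isBoundedHull.isClosed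
  have hVc : IsPreconnected V := hA.1.isBoundedHull.2.2.isPathConnected.isConnected.isPreconnected
  have h0U : (0 : ℂ) ∈ U := hA.zero_mem_plusDomain hne
  have hVn : ∀ n, V ⊆ upperHalfPlaneSet \ An n := fun n ↦
    hA.diff_subset_diff_of_plusDomain_subset (hAn n) (hdom n)
  have hEd : ∀ n, DifferentiableOn ℂ (E n) U := fun n ↦
    ((hAn n).differentiableOn_extMap (hnen n)).mono (hdom n)
  have hEinj : ∀ n, InjOn (E n) U := fun n ↦ ((hAn n).injOn_extMap (hnen n)).mono (hdom n)
  have hEV : ∀ n, ∀ z ∈ V, E n z ∈ upperHalfPlaneSet := fun n z hz ↦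
    (hAn n).extMap_mem_of_mem_diff (hnen n) (hVn n hz)
  have hE0 : ∀ n, E n 0 = 0 := fun n ↦ (hAn n).extMap_zero (hnen n)
  have hfmem : ∀ n, ∀ w ∈ upperHalfPlaneSet, f n w ∈ upperHalfPlaneSet \ An n := fun n w hw ↦
    ((hAn n).baseMap (hnen n)).symm_mapsTo hw
  have hEf : ∀ n, ∀ w ∈ upperHalfPlaneSet, E n (f n w) = w := fun n w hw ↦ by
    simp only [hE, hf]
    rw [(hAn n).extMap_of_mem_diff (hnen n) (hfmem n w hw), ConformalEquiv.apply_symm_apply _ hw]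
  have hfd : ∀ n, DifferentiableOn ℂ (f n) upperHalfPlaneSet := fun n ↦
    ((hAn n).baseMap (hnen n)).symm.differentiableOn_coe
  have hfinj : ∀ n, InjOn (f n) upperHalfPlaneSet := fun n ↦ ((hAn n).baseMap (hnen n)).symm.injOn
  have hfC : ∀ n, ∀ w ∈ upperHalfPlaneSet, ‖f n w - w‖ ≤ C := fun n w hw ↦ by
    have h : ‖E n (f n w) - f n w‖ ≤ C := hC n (f n w) ((hAn n).diff_subset_plusDomain (hfmem n w hw))
    rw [hEf n w hw] at h
    rwa [norm_sub_rev]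
  have hfim : ∀ n, ∀ w ∈ upperHalfPlaneSet, w.im ≤ (f n w).im := fun n w hw ↦ by
    have h := (hAn n).extMap_im_le_im (hnen n) (hfmem n w hw)
    rwa [show (hAn n).extMap (hnen n) (f n w) = w from hEf n w hw] at h
  have hC0 : 0 ≤ C := (norm_nonneg _).trans (hC 0 0 (hdom 0 h0U))
  -- a bound for `A`
  obtain ⟨R, hR⟩ := hA.1.isBoundedHull.isCompact.isBounded.subset_closedBall 0
  have hR0 : 0 ≤ R := (norm_nonneg _).trans (by simpa using hR hne.some_mem)
  -- Step 1: Montel for `E_n - id` on `U`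
  obtain ⟨h, φ₁, hφ₁, hhd, hlim₁, -⟩ :=
    Complex.exists_strictMono_tendstoLocallyUniformlyOn_of_norm_le hUo
      (F := fun n z ↦ E n z - z) (M := C) (fun n ↦ (hEd n).sub differentiableOn_id)
      (fun n z hz ↦ hC n z (hdom n hz))
  set Es : ℂ → ℂ := fun z ↦ h z + z with hEs
  have hlimE₁ : TendstoLocallyUniformlyOn (fun k ↦ E (φ₁ k)) Es atTop U := by
    have := tendstoLocallyUniformlyOn_add_id hlim₁
    simp only [sub_add_cancel] at this
    exact this
  -- Step 2: Montel for the inverses along `φ₁`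
  obtain ⟨g, φ₂, hφ₂, hgd, hlim₂, -⟩ :=
    Complex.exists_strictMono_tendstoLocallyUniformlyOn_of_norm_le isOpen_upperHalfPlaneSet
      (F := fun k w ↦ f (φ₁ k) w - w) (M := C) (fun k ↦ (hfd _).sub differentiableOn_id)
      (fun k w hw ↦ hfC _ w hw)
  set fs : ℂ → ℂ := fun w ↦ g w + w with hfs
  set φ : ℕ → ℕ := φ₁ ∘ φ₂ with hφdef
  have hφ : StrictMono φ := hφ₁.comp hφ₂
  have hlimE : TendstoLocallyUniformlyOn (fun k ↦ E (φ k)) Es atTop U := tendstoLocallyUniformlyOn_comp_strictMono hlimE₁ hφ₂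
  have hlimf : TendstoLocallyUniformlyOn (fun k ↦ f (φ k)) fs atTop upperHalfPlaneSet := by
    have := tendstoLocallyUniformlyOn_add_id hlim₂
    simp only [sub_add_cancel] at this
    exact this
  have hEsd : DifferentiableOn ℂ Es U := hhd.add differentiableOn_id
  have hfsd : DifferentiableOn ℂ fs upperHalfPlaneSet := hgd.add differentiableOn_id
  -- pointwise consequences of the convergence
  have hEsC : ∀ z ∈ U, ‖Es z - z‖ ≤ C := fun z hz ↦ by
    refine le_of_tendsto ((hlimE.tendsto_at hz).sub_const z |>.norm) (Eventually.of_forall fun k ↦ ?_)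
    exact hC _ z (hdom _ hz)
  have hEs0 : Es 0 = 0 :=
    tendsto_nhds_unique (hlimE.tendsto_at h0U) (by simp only [hE0]; exact tendsto_const_nhds)
  have hfsC : ∀ w ∈ upperHalfPlaneSet, ‖fs w - w‖ ≤ C := fun w hw ↦
    le_of_tendsto ((hlimf.tendsto_at hw).sub_const w |>.norm) (Eventually.of_forall fun k ↦ hfC _ w hw)
  have hfsim : ∀ w ∈ upperHalfPlaneSet, w.im ≤ (fs w).im := fun w hw ↦
    ge_of_tendsto ((continuous_im.tendsto _).comp (hlimf.tendsto_at hw))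
      (Eventually.of_forall fun k ↦ hfim _ w hw)
  have hfsH : MapsTo fs upperHalfPlaneSet upperHalfPlaneSet := fun w hw ↦
    show 0 < (fs w).im from lt_of_lt_of_le hw (hfsim w hw)
  have hEsim : ∀ z ∈ V, 0 ≤ (Es z).im := fun z hz ↦
    ge_of_tendsto ((continuous_im.tendsto _).comp (hlimE.tendsto_at (hVU hz)))
      (Eventually.of_forall fun k ↦ (show 0 < (E (φ k) z).im from hEV _ z hz).le)
  -- Step 3: `fs` is injective on `ℍ`
  have hfs_nc : ¬ ∃ c, EqOn fs (const ℂ c) upperHalfPlaneSet := by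
    rintro ⟨c, hc⟩
    have hw : ((|c.im| + 1 : ℝ) : ℂ) * Complex.I ∈ upperHalfPlaneSet := by
      show 0 < (((|c.im| + 1 : ℝ) : ℂ) * Complex.I).im
      simp; positivity
    have h1 := hfsim _ hw
    rw [hc hw] at h1
    simp [const] at h1
    linarith [le_abs_self c.im]
  have hfsinj : InjOn fs upperHalfPlaneSet := by
    rcases Complex.exists_eqOn_const_or_injOn_of_tendstoLocallyUniformlyOn isOpen_upperHalfPlaneSet
        (convex_halfSpace_im_gt 0).isPreconnected (Eventually.of_forall fun k ↦ hfd (φ k))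
        (Eventually.of_forall fun k ↦ hfinj (φ k)) hlimf with h | h
    · exact absurd h hfs_nc
    · exact h
  -- Step 4: `fs(ℍ)` misses `ℍ ∩ ∂A`
  have hfs_fr : ∀ w ∈ upperHalfPlaneSet, fs w ∉ upperHalfPlaneSet ∩ frontier A := by
    intro w₀ hw₀ hp
    set p := fs w₀ with hpdef
    have hlim' : TendstoLocallyUniformlyOn (fun k w ↦ f (φ k) w - p) (fun w ↦ fs w - p) atTop
        upperHalfPlaneSet := tendstoLocallyUniformlyOn_sub_const hlimf p
    have hev : ∀ᶠ k in atTop, ∀ w ∈ upperHalfPlaneSet, f (φ k) w - p ≠ 0 := by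
      filter_upwards [hφ.tendsto_atTop.eventually (hfr p hp)] with k hk w hw h0
      exact (hfmem (φ k) w hw).2 (by rw [sub_eq_zero] at h0; rwa [h0])
    rcases Complex.hurwitz_eqOn_zero_or_forall_ne_zero isOpen_upperHalfPlaneSet
        (convex_halfSpace_im_gt 0).isPreconnected
        (Eventually.of_forall fun k ↦ (hfd (φ k)).sub_const p) hlim' hev.frequently with h | h
    · refine hfs_nc ⟨p, fun w hw ↦ ?_⟩
      have := h hw
      simp only [Pi.zero_apply, sub_eq_zero] at this
      exact this
    · exact h w₀ hw₀ (by rw [hpdef, sub_self])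
  -- Step 5: `fs(ℍ) ⊆ ℍ ∖ A`
  have hfsV : MapsTo fs upperHalfPlaneSet V := by
    have hpre : IsPreconnected (fs '' upperHalfPlaneSet) :=
      (convex_halfSpace_im_gt 0).isPreconnected.image _ hfsd.continuousOn
    have hsub : fs '' upperHalfPlaneSet ⊆ V ∪ (upperHalfPlaneSet ∩ interior A) := by
      rintro _ ⟨w, hw, rfl⟩
      by_cases hint : fs w ∈ interior A
      · exact Or.inr ⟨hfsH hw, hint⟩
      · refine Or.inl ⟨hfsH hw, fun hmem ↦ hfs_fr w hw ⟨hfsH hw, ?_⟩⟩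
        rw [frontier, hA.1.isBoundedHull.isClosed.closure_eq]
        exact ⟨hmem, hint⟩
    have hdisj : Disjoint V (upperHalfPlaneSet ∩ interior A) :=
      Set.disjoint_left.2 fun z hz hz' ↦ hz.2 (interior_subset hz'.2)
    rcases hpre.subset_or_subset hVo (isOpen_upperHalfPlaneSet.inter isOpen_interior) hdisj hsub
      with h | h
    · exact fun w hw ↦ h ⟨w, hw, rfl⟩
    · -- a far point is not inside `A`
      exfalso
      set M : ℝ := R + C + 1 with hM
      have hMpos : 0 < M := by rw [hM]; linarith
      have hw : ((M : ℂ) * Complex.I) ∈ upperHalfPlaneSet := by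
        show 0 < ((M : ℂ) * Complex.I).im; simpa using hMpos
      have h1 := h ⟨_, hw, rfl⟩
      have h2 : fs (M * Complex.I) ∈ closedBall (0 : ℂ) R := hR (interior_subset h1.2)
      have h3 := hfsC _ hw
      rw [mem_closedBall, dist_zero_right] at h2
      have h4 : ‖(M : ℂ) * Complex.I‖ = M := by simp [abs_of_pos hMpos]
      have h5 : ‖(M : ℂ) * Complex.I‖ ≤ ‖fs (M * Complex.I)‖ + ‖fs (M * Complex.I) - M * Complex.I‖ := by
        calc ‖(M : ℂ) * Complex.I‖ = ‖fs (M * Complex.I) - (fs (M * Complex.I) - M * Complex.I)‖ := by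
              rw [sub_sub_cancel]
          _ ≤ _ := norm_sub_le _ _
      rw [h4] at h5
      linarith
  -- Step 6: `Es ∘ fs = id` on `ℍ`
  have hEsfs : ∀ w ∈ upperHalfPlaneSet, Es (fs w) = w := by
    intro w hw
    have hx : fs w ∈ U := hVU (hfsV hw)
    have hg : Tendsto (fun k ↦ f (φ k) w) atTop (𝓝[U] (fs w)) :=
      tendsto_nhdsWithin_iff.2 ⟨hlimf.tendsto_at hw,
        (hlimf.tendsto_at hw).eventually (hUo.mem_nhds hx)⟩
    have h1 : Tendsto (fun k ↦ E (φ k) (f (φ k) w)) atTop (𝓝 (Es (fs w))) :=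
      hlimE.tendsto_comp (hEsd.continuousOn.continuousWithinAt hx) hx hg
    have h2 : Tendsto (fun k ↦ E (φ k) (f (φ k) w)) atTop (𝓝 w) := by
      simp only [hEf _ w hw]; exact tendsto_const_nhds
    exact tendsto_nhds_unique h1 h2
  -- Step 7: `Es : ℍ ∖ A → ℍ` is a conformal bijection and a restriction map
  have hEs_nc : ¬ ∃ c, EqOn Es (const ℂ c) V := by
    rintro ⟨c, hc⟩
    -- `V` contains the far points `iM`, `M` large, where `Es ≈ id`
    set M : ℝ := R + ‖c‖ + C + 1 with hM
    have hMpos : 0 < M := by rw [hM]; positivity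
    have hzH : ((M : ℂ) * Complex.I) ∈ upperHalfPlaneSet := by
      show 0 < ((M : ℂ) * Complex.I).im; simpa using hMpos
    have hnorm : ‖(M : ℂ) * Complex.I‖ = M := by simp [abs_of_pos hMpos]
    have hzA : ((M : ℂ) * Complex.I) ∉ A := fun hmem ↦ by
      have := hR hmem
      rw [mem_closedBall, dist_zero_right, hnorm, hM] at this
      linarith [norm_nonneg c]
    have h1 := hEsC _ (hVU ⟨hzH, hzA⟩)
    rw [hc ⟨hzH, hzA⟩] at h1
    simp only [const_apply] at h1
    have h2 : ‖(M : ℂ) * Complex.I‖ ≤ ‖c‖ + ‖c - M * Complex.I‖ := by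
      calc ‖(M : ℂ) * Complex.I‖ = ‖c - (c - M * Complex.I)‖ := by rw [sub_sub_cancel]
        _ ≤ ‖c‖ + ‖c - M * Complex.I‖ := norm_sub_le _ _
    rw [hnorm] at h2
    linarith [norm_nonneg c]
  have hEsinj : InjOn Es V := by
    rcases Complex.exists_eqOn_const_or_injOn_of_tendstoLocallyUniformlyOn hVo hVc
        (Eventually.of_forall fun k ↦ (hEd (φ k)).mono hVU)
        (Eventually.of_forall fun k ↦ (hEinj (φ k)).mono hVU) (hlimE.mono hVU) with h | h
    · exact absurd h hEs_nc
    · exact h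
  have hEsan : AnalyticOnNhd ℂ Es V := (hEsd.mono hVU).analyticOnNhd hVo
  have hEsopen : ∀ s ⊆ V, IsOpen s → IsOpen (Es '' s) := by
    rcases hEsan.is_constant_or_isOpen hVc with h | h
    · obtain ⟨w, hw⟩ := h
      exact absurd ⟨w, fun z hz ↦ hw z hz⟩ hEs_nc
    · exact h
  have hEsH : MapsTo Es V upperHalfPlaneSet := by
    intro z hz
    have him := hEsim z hz
    rcases him.lt_or_eq with hpos | hzero
    · exact hpos
    · exfalso
      have hop := hEsopen V subset_rfl hVo
      obtain ⟨ε, hε, hball⟩ := Metric.isOpen_iff.1 hop (Es z) ⟨z, hz, rfl⟩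
      have hmem : Es z - (ε / 2 : ℝ) * Complex.I ∈ ball (Es z) ε := by
        rw [mem_ball, dist_eq_norm]
        have : Es z - (ε / 2 : ℝ) * Complex.I - Es z = -((ε / 2 : ℝ) * Complex.I) := by ring
        rw [this, norm_neg, norm_mul, Complex.norm_real, Complex.norm_I, mul_one, Real.norm_eq_abs,
          abs_of_pos (half_pos hε)]
        linarith
      obtain ⟨z', hz', hzz'⟩ := hball hmem
      have h1 := hEsim z' hz'
      rw [hzz'] at h1
      simp only [sub_im, mul_im, ofReal_re, I_im, mul_one, ofReal_im, I_re, mul_zero, add_zero] at h1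
      linarith
  have hEsurj : SurjOn Es V upperHalfPlaneSet := fun w hw ↦ ⟨fs w, hfsV hw, hEsfs w hw⟩
  have hEbij : BijOn Es V upperHalfPlaneSet := ⟨hEsH, hEsinj, hEsurj⟩
  have hEsdV : DifferentiableOn ℂ Es V := hEsd.mono hVU
  have hinvd : DifferentiableOn ℂ (invFunOn Es V) upperHalfPlaneSet := by
    rw [← hEbij.image_eq]
    exact Complex.differentiableOn_invFunOn_image hVo hEsdV hEsinj fun z hz ↦
      Literature.Analysis.Complex.SCV.deriv_ne_zero_of_injOn hEsdV hVo hEsinj hz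
  set Ψ : ConformalEquiv (upperHalfPlaneSet \ A) upperHalfPlaneSet :=
    ConformalEquiv.ofBijOn Es hEsdV hEbij hinvd with hΨ
  have hΨres : IsRestrictionMap A Ψ := by
    refine ⟨?_, ?_⟩
    · -- boundary value `0` at `0`: `Es` is continuous at `0 ∈ U` with `Es 0 = 0`
      show Tendsto Ψ (𝓝[V] 0) (𝓝 0)
      have hc : ContinuousAt Es 0 := (hEsd.differentiableAt (hUo.mem_nhds h0U)).continuousAt
      have := hc.tendsto
      rw [hEs0] at this
      exact this.mono_left nhdsWithin_le_nhds
    · -- `Es z / z → 1`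
      show Tendsto (fun z ↦ Es z / z) (cocompact ℂ ⊓ 𝓟 V) (𝓝 1)
      have h1 : Tendsto (fun z : ℂ ↦ (Es z - z) / z) (cocompact ℂ ⊓ 𝓟 V) (𝓝 0) := by
        have hb : ∀ᶠ z in cocompact ℂ ⊓ 𝓟 V, ‖(Es z - z) / z‖ ≤ C * ‖z⁻¹‖ := by
          filter_upwards [mem_inf_of_right (mem_principal_self V)] with z hz
          rw [norm_div, norm_inv, div_eq_mul_inv]
          exact mul_le_mul_of_nonneg_right (hEsC z (hVU hz)) (inv_nonneg.2 (norm_nonneg _))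
        have h0 : Tendsto (fun z : ℂ ↦ C * ‖z⁻¹‖) (cocompact ℂ ⊓ 𝓟 V) (𝓝 0) := by
          have h3 : Tendsto (fun z : ℂ ↦ z⁻¹) (cocompact ℂ ⊓ 𝓟 V) (𝓝 0) := by
            refine Tendsto.mono_left ?_ inf_le_left
            rw [← cobounded_eq_cocompact]; exact tendsto_inv₀_cobounded
          have h4 := h3.norm.const_mul C
          simpa using h4
        exact squeeze_zero_norm' hb h0
      have hev : ∀ᶠ z : ℂ in cocompact ℂ ⊓ 𝓟 V, z ≠ 0 :=
        mem_inf_of_left (isCompact_singleton.compl_mem_cocompact)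
      have h2 := h1.const_add 1
      rw [add_zero] at h2
      refine h2.congr' ?_
      filter_upwards [hev] with z hz
      show 1 + (Es z - z) / z = Es z / z
      field_simp
      ring
  have hEsV : EqOn Es (hA.extMap hne) V := fun z hz ↦ by
    have h1 := hA.eqOn_baseMap hne hΨres hz
    rw [hΨ, ConformalEquiv.ofBijOn_apply] at h1
    rw [h1, hA.extMap_of_mem_diff hne hz]
  -- Step 8: identity theorem on `U`
  have hEsU : EqOn Es (hA.extMap hne) U := by
    obtain ⟨z₀, hz₀⟩ : V.Nonempty := hA.1.isBoundedHull.2.2.isPathConnected.isConnected.nonempty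
    have han₁ : AnalyticOnNhd ℂ Es U := hEsd.analyticOnNhd hUo
    have han₂ : AnalyticOnNhd ℂ (hA.extMap hne) U := (hA.differentiableOn_extMap hne).analyticOnNhd hUo
    exact han₁.eqOn_of_preconnected_of_eventuallyEq han₂ hUc (hVU hz₀)
      (eventuallyEq_of_mem (hVo.mem_nhds hz₀) hEsV)
  exact ⟨φ, hφ, hlimE.congr_right hEsU⟩

/-- **Kernel theorem for hulls swallowing `ℍ ∩ ∂A`.** Let `A, A_n ∈ 𝒬₊` be nonempty with
`Ω_A ⊆ Ω_{A_n}`, `‖E_{A_n} z - z‖ ≤ C` on `Ω_{A_n}` for all `n`, and every point of `ℍ ∩ ∂A`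
eventually in `A_n`. Then `E_{A_n} → E_A` locally uniformly on `Ω_A` (the subsequence principle
applied to `IsPlusHull.exists_strictMono_tendstoLocallyUniformlyOn_extMap`). For the slits
`β[0, t] ↑` of the boundary path of a smooth hull this is the convergence
"`Φ_t → Φ_{E_δ}` in `ℍ̄ ∖ E_δ`" of [LSW] p. 13. [cite: LawlerSchrammWerner2003Restriction, proof of Lemma 3.5 (p. 13)] -/
theorem IsPlusHull.tendstoLocallyUniformlyOn_extMap_of_frontier :
    TendstoLocallyUniformlyOn (fun n ↦ (hAn n).extMap (hnen n)) (hA.extMap hne) atTop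
      (plusDomain A) := by
  rw [tendstoLocallyUniformlyOn_iff_forall_isCompact hA.isOpen_plusDomain]
  intro K hKU hK
  rw [Metric.tendstoUniformlyOn_iff]
  intro ε hε
  by_contra hcon
  rw [not_eventually] at hcon
  -- a bad subsequence
  obtain ⟨ψ, hψ, hbad⟩ := extraction_of_frequently_atTop hcon
  -- the hypotheses pass to the subsequence
  have hfr' : ∀ z ∈ upperHalfPlaneSet ∩ frontier A, ∀ᶠ k in atTop, z ∈ An (ψ k) := fun z hz ↦
    hψ.tendsto_atTop.eventually (hfr z hz)
  obtain ⟨φ, hφ, hlim⟩ := hA.exists_strictMono_tendstoLocallyUniformlyOn_extMap hne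
    (fun k ↦ hAn (ψ k)) (fun k ↦ hnen (ψ k)) (fun k ↦ hdom (ψ k)) (fun k ↦ hC (ψ k)) hfr'
  have hunif := (tendstoLocallyUniformlyOn_iff_forall_isCompact hA.isOpen_plusDomain).1 hlim K hKU hK
  rw [Metric.tendstoUniformlyOn_iff] at hunif
  obtain ⟨k, hk⟩ := (hunif ε hε).exists
  have hb := hbad (φ k)
  push Not at hb
  obtain ⟨z, hzK, hz⟩ := hb
  exact absurd (hk z hzK) (not_lt.2 hz)

end Kernel

end Literature.Probability.RandomPlanarGeometry
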